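import Mathlib
import Summits.ValiantsHypothesis.ValiantsHypothesis.Theorems.NewtonUnitEquationsDissociatedUniformTotalsLawLaps
import Summits.ValiantsHypothesis.ValiantsHypothesis.Theorems.NewtonUnitEquationsDissociatedUniformTotalsLawUnionCoSmall
import HarnessLib

/-!
# Crux `NewtonUnitEquations.DissociatedUniform` (stmt-ValiantsHypothesis-5905): the uniform pointwise bound under CO-MONOTONE MODE LIFTS

Companion of `…TotalsLawLaps` (`card_forwardChainPoints_le`: forward-chain points of co-monotone lifts number `≤ 3q`) and
`…TotalsLawChains` (chain localisation).  This file assembles the KINETIC COUNT of memo `Cruxes/DissociatedUniform/NOTES-t1g6.md` §3: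

* `card_backwardChainPoints_le`: backward chains of monotone lifts also number `≤ 3q` (label negation turns them into forward chains of
  the lifts `q − 1 − P` along reversed time);
* `isStrictTop_mode_of_generic`: at a chart time generic for the pair sumset the witness mode is THE strict top of `A` (resp. `B`);
* **`ncard_chartExposed_le`**: if along the chart `t ↦ (σ,t)` the strict modes of `a`, `b` are `x₀ + P(τ t)`, `y₀ + Q(τ t)` for lifts
  `P, Q : T → ℕ` monotone along a common reparametrisation `τ : ℝ → T` (a CO-ORIENTED pair on this chart), the hull vertices of `U_s(Z)`
  exposed on this chart number `≤ 6q`;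
* **`unionVert_le_of_lifts`**: co-monotone lifts on both charts ⇒ `#vert conv U_s(Z) ≤ 12·q` for EVERY `Z`, `s` — the first UNIFORM
  pointwise bound on (the co-oriented part of) the convexly ordered stratum, modulo the lift hypothesis.
What is NOT here: the lift hypothesis itself.  For locally strict (no three consecutive collinear points) co-oriented convexly ordered
curves it follows from the mode toolkit `…TotalsLawModes` (successive chart modes are adjacent labels and move one way; memo §3 (K3)) —
left to the next seat; contra-oriented pairs need a different count (memo §3 (K2)).  Constants are not optimised (`4q − 2|W|` is the truth
for co-oriented pairs, attained).
Honest label: a conditional structural theorem on a stratum; `ConvexUnionVertBound C` (`C ≥ 3`), `UnionTotalsLaw`, `TotalsLawThree` remain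
OPEN; nothing here bears on VP ≠ VNP.
[folklore]
-/

set_option linter.dupNamespace false -- `ValiantsHypothesis.ValiantsHypothesis` (summit = problem) in every name

open scoped BigOperators Pointwise

namespace Summit.ValiantsHypothesis.ValiantsHypothesis.Theorems.NewtonUnitEquationsDissociatedUniform

namespace TotalsLaw

open Literature.Computability.AlgebraicComplexity.KPTT.PlanarMinkowski

section LiftCount

variable {q : ℕ} [NeZero q]

/-- **Backward chains, by label negation.**  For monotone lifts `P, Q` the BACKWARD-chain points `(x₀ + P t - i, y₀ + Q t - j)` (fibre
`m_t - (i+j)` present, fibres `m_t - n`, `n < i + j`, absent) also number at most `3q`: negating all labels turns them into the forward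
chains of the antitone lifts `q - 1 - P`, `q - 1 - Q`, i.e. of monotone lifts along reversed time. [folklore] -/
theorem card_backwardChainPoints_le {T : Type*} [LinearOrder T] [Nonempty T] (W : Finset (ZMod q)) (x₀ y₀ : ZMod q)
    (P Q : T → ℕ) (hP : Monotone P) (hQ : Monotone Q) (hPq : ∀ t, P t < q) (hQq : ∀ t, Q t < q)
    (C : Finset (ZMod q × ZMod q))
    (hC : ∀ xy ∈ C, ∃ (t : T) (i j : ℕ), xy = (x₀ + (P t : ZMod q) - (i : ZMod q), y₀ + (Q t : ZMod q) - (j : ZMod q)) ∧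
      x₀ + y₀ + (P t : ZMod q) + (Q t : ZMod q) - ((i + j : ℕ) : ZMod q) ∈ W ∧
      ∀ n : ℕ, n < i + j → x₀ + y₀ + (P t : ZMod q) + (Q t : ZMod q) - (n : ZMod q) ∉ W) :
    C.card ≤ 3 * q := by
  classical
  have hq1 : 1 ≤ q := Nat.one_le_iff_ne_zero.2 (NeZero.ne q)
  -- negated data
  set W' : Finset (ZMod q) := W.image (fun z => -z) with hW'
  set x₀' : ZMod q := -x₀ - ((q - 1 : ℕ) : ZMod q) with hx₀'
  set y₀' : ZMod q := -y₀ - ((q - 1 : ℕ) : ZMod q) with hy₀'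
  let P' : Tᵒᵈ → ℕ := fun t => q - 1 - P (OrderDual.ofDual t)
  let Q' : Tᵒᵈ → ℕ := fun t => q - 1 - Q (OrderDual.ofDual t)
  have hP' : Monotone P' := fun t₁ t₂ h => by
    have := hP (OrderDual.ofDual_le_ofDual.2 h)
    simp only [P']; omega
  have hQ' : Monotone Q' := fun t₁ t₂ h => by
    have := hQ (OrderDual.ofDual_le_ofDual.2 h)
    simp only [Q']; omega
  have hP'q : ∀ t, P' t < q := fun t => by simp only [P']; omega
  have hQ'q : ∀ t, Q' t < q := fun t => by simp only [Q']; omega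
  -- cast identities: `x₀' + P' t = -(x₀ + P t)`
  have hcastP : ∀ t : T, x₀' + ((q - 1 - P t : ℕ) : ZMod q) = -(x₀ + (P t : ZMod q)) := fun t => by
    rw [hx₀', Nat.cast_sub (show P t ≤ q - 1 by have := hPq t; omega), Nat.cast_sub hq1]; push_cast; ring
  have hcastQ : ∀ t : T, y₀' + ((q - 1 - Q t : ℕ) : ZMod q) = -(y₀ + (Q t : ZMod q)) := fun t => by
    rw [hy₀', Nat.cast_sub (show Q t ≤ q - 1 by have := hQq t; omega), Nat.cast_sub hq1]; push_cast; ring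
  have hmemW' : ∀ z : ZMod q, -z ∈ W' ↔ z ∈ W := fun z => by
    rw [hW', Finset.mem_image]
    constructor
    · rintro ⟨z', hz', h⟩
      have : z' = z := neg_injective h
      rwa [← this]
    · exact fun hz => ⟨z, hz, rfl⟩
  set C' : Finset (ZMod q × ZMod q) := C.image (fun xy => (-xy.1, -xy.2)) with hC'
  have hcard : C'.card = C.card := by
    rw [hC']
    exact Finset.card_image_of_injective _ fun xy xy' h => by
      simp only [Prod.mk.injEq, neg_inj] at h
      exact Prod.ext h.1 h.2
  rw [← hcard]
  refine card_forwardChainPoints_le W' x₀' y₀' P' Q' hP' hQ' hP'q hQ'q C' fun xy' hxy' => ?_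
  obtain ⟨xy, hxy, rfl⟩ := Finset.mem_image.1 hxy'
  obtain ⟨t, i, j, hxyeq, hmem, hmin⟩ := hC xy hxy
  refine ⟨OrderDual.toDual t, i, j, ?_, ?_, fun n hn => ?_⟩
  · rw [hxyeq]
    simp only [P', Q', OrderDual.ofDual_toDual, Prod.mk.injEq]
    constructor
    · rw [show x₀' + ((q - 1 - P t : ℕ) : ZMod q) + (i : ZMod q) = -(x₀ + (P t : ZMod q)) + i by rw [hcastP]]; ring
    · rw [show y₀' + ((q - 1 - Q t : ℕ) : ZMod q) + (j : ZMod q) = -(y₀ + (Q t : ZMod q)) + j by rw [hcastQ]]; ring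
  · simp only [P', Q', OrderDual.ofDual_toDual]
    have : x₀' + y₀' + ((q - 1 - P t : ℕ) : ZMod q) + ((q - 1 - Q t : ℕ) : ZMod q) + ((i + j : ℕ) : ZMod q) =
        -(x₀ + y₀ + (P t : ZMod q) + (Q t : ZMod q) - ((i + j : ℕ) : ZMod q)) := by
      have e1 := hcastP t; have e2 := hcastQ t
      linear_combination e1 + e2
    rw [this, hmemW']; exact hmem
  · simp only [P', Q', OrderDual.ofDual_toDual]
    have : x₀' + y₀' + ((q - 1 - P t : ℕ) : ZMod q) + ((q - 1 - Q t : ℕ) : ZMod q) + (n : ZMod q) =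
        -(x₀ + y₀ + (P t : ZMod q) + (Q t : ZMod q) - (n : ZMod q)) := by
      have e1 := hcastP t; have e2 := hcastQ t
      linear_combination e1 + e2
    rw [this, hmemW']; exact hmin n hn

variable (a b : ZMod q → (Fin 2 → ℝ))

/-- At a time generic for the pair sumset, the mode label of a cyclically unimodal witness is the strict top of `A`.
[folklore] -/
theorem isStrictTop_mode_of_generic {σ t : ℝ} (hgen : Generic σ (pairFin a b) t) {nα : ZMod q} {dα : ℕ}
    (hα : CycUnimodalAt (fun x => ![σ, t] ⬝ᵥ a x) nα dα) :
    IsStrictTop ![σ, t] (Finset.univ.image a) (a (nα + (dα : ZMod q))) := by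
  classical
  refine ⟨Finset.mem_image_of_mem a (Finset.mem_univ _), fun y hy hne => ?_⟩
  obtain ⟨x, -, rfl⟩ := Finset.mem_image.1 hy
  refine lt_of_le_of_ne (hα.le_mode x) fun heq => hne ?_
  -- genericity for the pair sumset separates `a x + b 0` from `a m + b 0`
  by_contra hne'
  have h1 : a x + b 0 ∈ pairFin a b := Finset.mem_image.2 ⟨(x, 0), Finset.mem_univ _, rfl⟩
  have h2 : a (nα + (dα : ZMod q)) + b 0 ∈ pairFin a b :=
    Finset.mem_image.2 ⟨(nα + (dα : ZMod q), 0), Finset.mem_univ _, rfl⟩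
  have hne2 : a x + b 0 ≠ a (nα + (dα : ZMod q)) + b 0 := fun h => hne' (add_right_cancel h)
  apply hgen _ h1 _ h2 hne2
  rw [dotProduct_add, dotProduct_add, heq]

/-- The same for the second curve. [folklore] -/
theorem isStrictTop_mode_of_generic' {σ t : ℝ} (hgen : Generic σ (pairFin a b) t) {nβ : ZMod q} {dβ : ℕ}
    (hβ : CycUnimodalAt (fun y => ![σ, t] ⬝ᵥ b y) nβ dβ) :
    IsStrictTop ![σ, t] (Finset.univ.image b) (b (nβ + (dβ : ZMod q))) := by
  classical
  refine ⟨Finset.mem_image_of_mem b (Finset.mem_univ _), fun y hy hne => ?_⟩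
  obtain ⟨x, -, rfl⟩ := Finset.mem_image.1 hy
  refine lt_of_le_of_ne (hβ.le_mode x) fun heq => hne ?_
  by_contra hne'
  have h1 : a 0 + b x ∈ pairFin a b := Finset.mem_image.2 ⟨(0, x), Finset.mem_univ _, rfl⟩
  have h2 : a 0 + b (nβ + (dβ : ZMod q)) ∈ pairFin a b :=
    Finset.mem_image.2 ⟨(0, nβ + (dβ : ZMod q)), Finset.mem_univ _, rfl⟩
  have hne2 : a 0 + b x ≠ a 0 + b (nβ + (dβ : ZMod q)) := fun h => hne' (add_left_cancel h)
  apply hgen _ h1 _ h2 hne2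
  rw [dotProduct_add, dotProduct_add, heq]

/-- **Chart count under co-monotone lifts.**  Suppose that along the chart `t ↦ (σ, t)` the strict modes of `a` and `b` are
`x₀ + P(τ t)` and `y₀ + Q(τ t)` for lifts `P, Q : T → ℕ` (`< q`) that are monotone along a common reparametrisation `τ : ℝ → T` of time
(a CO-ORIENTED pair on this chart).  Then the hull vertices of `U_s(Z)` exposed on this chart at times generic for the pair sumset
number at most `6q` (`3q` forward-chain points + `3q` backward-chain points, `card_forwardChainPoints_le`). [folklore] -/
theorem ncard_chartExposed_le (ha : ConvexlyOrdered a) (hb : ConvexlyOrdered b) (Z : Finset (ZMod q)) (s : ZMod q) (σ : ℝ)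
    {T : Type*} [LinearOrder T] [Nonempty T] (τ : ℝ → T) (x₀ y₀ : ZMod q) (P Q : T → ℕ) (hP : Monotone P)
    (hQ : Monotone Q) (hPq : ∀ t, P t < q) (hQq : ∀ t, Q t < q)
    (hPA : ∀ (t : ℝ) (x : ZMod q), IsStrictTop ![σ, t] (Finset.univ.image a) (a x) → x = x₀ + (P (τ t) : ZMod q))
    (hQB : ∀ (t : ℝ) (y : ZMod q), IsStrictTop ![σ, t] (Finset.univ.image b) (b y) → y = y₀ + (Q (τ t) : ZMod q)) :
    {p : Fin 2 → ℝ | ∃ t : ℝ, Generic σ (pairFin a b) t ∧ IsStrictTop ![σ, t] (unionFin a b (Z : Set (ZMod q)) s) p}.ncard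
      ≤ 6 * q := by
  classical
  -- present fibres
  set W : Finset (ZMod q) := Finset.univ.filter fun r => s - r ∈ Z with hWdef
  have hWmem : ∀ r : ZMod q, r ∈ W ↔ s - r ∈ Z := fun r => by simp [hWdef]
  -- the two candidate sets
  set CF : Finset (ZMod q × ZMod q) := Finset.univ.filter fun xy => ∃ (t : T) (i j : ℕ),
      xy = (x₀ + (P t : ZMod q) + (i : ZMod q), y₀ + (Q t : ZMod q) + (j : ZMod q)) ∧
      x₀ + y₀ + (P t : ZMod q) + (Q t : ZMod q) + ((i + j : ℕ) : ZMod q) ∈ W ∧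
      ∀ n : ℕ, n < i + j → x₀ + y₀ + (P t : ZMod q) + (Q t : ZMod q) + (n : ZMod q) ∉ W with hCF
  set CB : Finset (ZMod q × ZMod q) := Finset.univ.filter fun xy => ∃ (t : T) (i j : ℕ),
      xy = (x₀ + (P t : ZMod q) - (i : ZMod q), y₀ + (Q t : ZMod q) - (j : ZMod q)) ∧
      x₀ + y₀ + (P t : ZMod q) + (Q t : ZMod q) - ((i + j : ℕ) : ZMod q) ∈ W ∧
      ∀ n : ℕ, n < i + j → x₀ + y₀ + (P t : ZMod q) + (Q t : ZMod q) - (n : ZMod q) ∉ W with hCB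
  have hcardF : CF.card ≤ 3 * q :=
    card_forwardChainPoints_le W x₀ y₀ P Q hP hQ hPq hQq CF fun xy hxy => (Finset.mem_filter.1 hxy).2
  have hcardB : CB.card ≤ 3 * q :=
    card_backwardChainPoints_le W x₀ y₀ P Q hP hQ hPq hQq CB fun xy hxy => (Finset.mem_filter.1 hxy).2
  -- cover
  set Img : Finset (Fin 2 → ℝ) := (CF ∪ CB).image fun xy => a xy.1 + b xy.2 with hImg
  have hcover : {p : Fin 2 → ℝ | ∃ t : ℝ, Generic σ (pairFin a b) t ∧
      IsStrictTop ![σ, t] (unionFin a b (Z : Set (ZMod q)) s) p} ⊆ (Img : Set (Fin 2 → ℝ)) := by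
    rintro p ⟨t, hgen, htop⟩
    obtain ⟨nα, dα, hα⟩ := ha ![σ, t]
    obtain ⟨nβ, dβ, hβ⟩ := hb ![σ, t]
    have hmα : nα + (dα : ZMod q) = x₀ + (P (τ t) : ZMod q) := hPA t _ (isStrictTop_mode_of_generic a b hgen hα)
    have hmβ : nβ + (dβ : ZMod q) = y₀ + (Q (τ t) : ZMod q) := hQB t _ (isStrictTop_mode_of_generic' a b hgen hβ)
    rw [Finset.mem_coe, hImg, Finset.mem_image]
    rcases exists_chain_of_isStrictTop a b hα hβ Z s htop with ⟨i, j, hp, hZ, hmin⟩ | ⟨i, j, hp, hZ, hmin⟩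
    · refine ⟨(x₀ + (P (τ t) : ZMod q) + (i : ZMod q), y₀ + (Q (τ t) : ZMod q) + (j : ZMod q)),
        Finset.mem_union_left _ (Finset.mem_filter.2 ⟨Finset.mem_univ _, τ t, i, j, rfl, ?_, fun n hn => ?_⟩), ?_⟩
      · rw [hWmem]; convert hZ using 2; rw [hmα, hmβ]; ring
      · rw [hWmem]; have := hmin n hn; convert this using 2; rw [hmα, hmβ]; ring
      · rw [hp, hmα, hmβ]
    · refine ⟨(x₀ + (P (τ t) : ZMod q) - (i : ZMod q), y₀ + (Q (τ t) : ZMod q) - (j : ZMod q)),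
        Finset.mem_union_right _ (Finset.mem_filter.2 ⟨Finset.mem_univ _, τ t, i, j, rfl, ?_, fun n hn => ?_⟩), ?_⟩
      · rw [hWmem]; convert hZ using 2; rw [hmα, hmβ]; ring
      · rw [hWmem]; have := hmin n hn; convert this using 2; rw [hmα, hmβ]; ring
      · rw [hp, hmα, hmβ]
  calc {p : Fin 2 → ℝ | ∃ t : ℝ, Generic σ (pairFin a b) t ∧
          IsStrictTop ![σ, t] (unionFin a b (Z : Set (ZMod q)) s) p}.ncard
      ≤ (Img : Set (Fin 2 → ℝ)).ncard := Set.ncard_le_ncard hcover (Finset.finite_toSet _)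
    _ = Img.card := Set.ncard_coe_finset _
    _ ≤ (CF ∪ CB).card := Finset.card_image_le
    _ ≤ CF.card + CB.card := Finset.card_union_le _ _
    _ ≤ 3 * q + 3 * q := add_le_add hcardF hcardB
    _ = 6 * q := by ring

/-- **Uniform pointwise bound under co-monotone lifts on both charts**: if on each of the two charts `σ = ±1` the strict modes of the
convexly ordered curves `a`, `b` admit co-monotone lifts, then `#vert conv U_s(Z) ≤ 12·q` for EVERY position set `Z` and class `s`.
(Every hull vertex is exposed at a chart time generic for the pair sumset, `exists_generic_isStrictTop`.)  The lift hypothesis is the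
kinetic input of memo NOTES-t1g6 §3 (K3) — for locally strict co-oriented pairs it is supplied by the mode toolkit of `…TotalsLawModes`
(successive chart modes are adjacent and move one way); it is NOT discharged in this file. [folklore] -/
theorem unionVert_le_of_lifts (ha : ConvexlyOrdered a) (hb : ConvexlyOrdered b) (Z : Finset (ZMod q)) (s : ZMod q)
    (hlift : ∀ σ : ℝ, σ = 1 ∨ σ = -1 → ∃ (T : Type) (_ : LinearOrder T) (_ : Nonempty T) (τ : ℝ → T) (x₀ y₀ : ZMod q)
      (P Q : T → ℕ), Monotone P ∧ Monotone Q ∧ (∀ t, P t < q) ∧ (∀ t, Q t < q) ∧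
      (∀ (t : ℝ) (x : ZMod q), IsStrictTop ![σ, t] (Finset.univ.image a) (a x) → x = x₀ + (P (τ t) : ZMod q)) ∧
      (∀ (t : ℝ) (y : ZMod q), IsStrictTop ![σ, t] (Finset.univ.image b) (b y) → y = y₀ + (Q (τ t) : ZMod q))) :
    unionVert a b (Z : Set (ZMod q)) s ≤ 12 * q := by
  classical
  set E : ℝ → Set (Fin 2 → ℝ) := fun σ => {p : Fin 2 → ℝ | ∃ t : ℝ, Generic σ (pairFin a b) t ∧
      IsStrictTop ![σ, t] (unionFin a b (Z : Set (ZMod q)) s) p} with hE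
  have hEle : ∀ σ : ℝ, σ = 1 ∨ σ = -1 → (E σ).ncard ≤ 6 * q := by
    intro σ hσ
    obtain ⟨T, _, _, τ, x₀, y₀, P, Q, hP, hQ, hPq, hQq, hPA, hQB⟩ := hlift σ hσ
    exact ncard_chartExposed_le a b ha hb Z s σ τ x₀ y₀ P Q hP hQ hPq hQq hPA hQB
  have hEfin : ∀ σ : ℝ, (E σ).Finite := fun σ =>
    (Finset.finite_toSet (unionFin a b (Z : Set (ZMod q)) s)).subset fun p ⟨t, _, htop⟩ => htop.mem
  have hcover : (convexHull ℝ (unionPts a b (Z : Set (ZMod q)) s)).extremePoints ℝ ⊆ E 1 ∪ E (-1) := by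
    intro p hp
    rw [← coe_unionFin a b (Z : Set (ZMod q)) s] at hp
    obtain ⟨σ, t, hσ, hgen, -, htop⟩ :=
      exists_generic_isStrictTop (unionFin a b (Z : Set (ZMod q)) s) (pairFin a b) (pairFin a b) hp
    rcases hσ with rfl | rfl
    · exact Or.inl ⟨t, hgen, htop⟩
    · exact Or.inr ⟨t, hgen, htop⟩
  unfold unionVert
  calc ((convexHull ℝ (unionPts a b (Z : Set (ZMod q)) s)).extremePoints ℝ).ncard
      ≤ (E 1 ∪ E (-1)).ncard := Set.ncard_le_ncard hcover ((hEfin 1).union (hEfin (-1)))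
    _ ≤ (E 1).ncard + (E (-1)).ncard := Set.ncard_union_le _ _
    _ ≤ 6 * q + 6 * q := add_le_add (hEle 1 (Or.inl rfl)) (hEle (-1) (Or.inr rfl))
    _ = 12 * q := by ring

end LiftCount

end TotalsLaw

end Summit.ValiantsHypothesis.ValiantsHypothesis.Theorems.NewtonUnitEquationsDissociatedUniform
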